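import Literature.Geometry.Kaehler.ComplexTorusEquivariantEndomorphismAlgebraCommutantCyclicRoanFactorSimple
import Literature.Geometry.Kaehler.ComplexTorusEquivariantEndomorphismAlgebraCommutantCyclicSwapCertificate
import Literature.Geometry.Kaehler.ComplexTorusKernelIdeals
import HarnessLib

/-!
# The Galois twists of the order-`8` certificate `u : (z, w) ↦ (iw, z)` on `E_i × E_i`: `u ∼ u⁵ = −u` by the isogeny
# `(z, w) ↦ (z, −w)`, `u ≁ u³`, `u ≁ u⁷ = u⁻¹` — the stabiliser of `Φ_8(u)` is `{1, τ_5} = Gal(ℚ(ζ_8)/ℚ(i))`, and the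
# Roan factor `Y_8` is NOT simple

Layer `Literature/Geometry/Kaehler`, namespace `Literature.Geometry.Kaehler.ComplexTorus`; lane `lit-hodgefound`
(Track 2 foundations library), Layer A2, row «A2-26(fn)» (self-proposed 2026-08-28, prover seat `lit-hodgefound-p10`,
generation 30, FILE 3).  The WITNESS file of generation 30: FILE 1 proved «`u|X^{e_d} ∼ (u|X^{e_d})^k` by an isogeny
iff `Φ_d(u)τ_k = Φ_d(u)`» and «never `u ∼ u⁻¹`», FILE 2 «`X^{e_d}` simple iff the stabiliser of `Φ_d(u)` is trivial».
Generation 28 FILE 1 built the certificate `u = swapI = (0 J; 1 0)` of order `8` on `E_i × E_i` (`P^r_u = Φ_8`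
squarefree, `D(u) = {8}`, `h_8 = 1`).  Here, with NO new definition:

* §1 (any two tori `X₁`, `X₂`) the integer matrix `(1 0; 0 −1)` is an isogeny (indeed an automorphism) of `X₁ × X₂`;
* §2 on `E_i × E_i`: `(1 0; 0 −1) u = u⁵ (1 0; 0 −1)` (`u⁵ = u⁴u = −u`), so **`u` IS ISOGENY-CONJUGATE TO `u⁵ = −u`**;
  by FILE 1 §6 **`u ≁ u⁷ = u⁻¹`**, and composing, **`u ≁ u³`** (an isogeny `A u = u³ A` composed with `B u = u⁵ B`
  would give `(A B) u = u¹⁵ (A B) = u⁷ (A B)`): among `k ∈ (ℤ/8)^× = {1, 3, 5, 7}` exactly `k ∈ {1, 5}` occur;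
* §3 on the CM type `Φ_8(u)` of the Roan factor `Y_8 = X^{e_8(u)}` (a CM torus by `ℚ(ζ_8)`, generation 29):
  **`Φ_8(u)τ_5 = Φ_8(u)`**, `Φ_8(u)τ_7 = Φ̄_8(u) ≠ Φ_8(u)`, **`Φ_8(u)τ_3 ≠ Φ_8(u)`** — the stabiliser of `Φ_8(u)` in
  `Aut ℚ(ζ_8) ≅ (ℤ/8)^×` is `{1, τ_5}`, the group fixing `ζ_8² = i`, i.e. `Gal(ℚ(ζ_8)/ℚ(i))`: `Φ_8(u)` is induced from
  `ℚ(i)` (as it must: `Y_8 ∼ E_i²`), and by FILE 2 **`Y_8` is NOT simple**; `Spec ρ_a(u)` is stable under `μ ↦ μ⁵`.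

CONSUMED BY NAME: generation 28 `swapI_map_intCast` / `swapI_mem_endAlgRat` / `swapEnd_pow_eight` / `swapI_map_pow_four` /
`squarefree_charpoly_swapI` / `eigenvalueOrders_swapI`, Lange's `fromBlocks_mem_endAlgRat_prod_iff` / `IsIsogeny.mul`,
Kieffer's `isIsogeny_of_mem_endRingInt`, generation 30 FILE 1 `hasEigenvalue_pow_of_isIsogeny_pow` /
`inducedCMType_cmType_roanFactor_eq_self_of_isIsogeny_pow` / `not_exists_isIsogeny_pow_sub_one` /
`inducedCMType_symm_ne_self_of_apply_zeta_eq_inv` / `exists_algEquiv_apply_zeta_eq_pow`, FILE 2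
`zeta_pow_eq_zeta_of_isSimple_of_isIsogeny_pow`, p11 `twist_mul`.  Theorems only; NO definition, NO named fact,
NO instance (D-0026, net debt 0).

## The print

* G. Shimura, *Abelian Varieties with Complex Multiplication and Modular Functions* (1998), §8.4 Example (2), p. 73
  (p0085): for `F = Q(ζ)` the CM types fall into families «transformed onto each other by an automorphism of `F`»;
  the non-primitive ones have a non-trivial stabiliser (here `F = ℚ(ζ_8)`, `Φ = {1, 5}` induced from `ℚ(i)`); §6.2
  Thm. 3 (`ℂ²/D(𝔪)` of type `(ℚ(ζ_8); {φᵢ})`), p. 42; §5.2, p. 39.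
* I. Dolgachev, Yu. G. Zarhin, *Endomorphisms of Complex Abelian Varieties* (2024), §2.2 Thm. 2.18 (the alternative
  `A ∼ B^r`; `E_i × E_i` with `ℤ/8`), p0036.
* M. Streng, thesis Leiden (2010), Ch. I §3–§4 (equivalent types `Φσ`), (3.6) «`Gal(L/K₁) = {σ | Φ_L σ = Φ_L}`».
* H. Lange, *Abelian Varieties over the Complex Numbers* (2023), §1.1.2 Lemma 1.1.11, Cor. 1.1.16 (isogenies compose),
  §2.4.4 Cor. 2.4.26 (block form of `End_ℚ(X₁ × X₂)`), §2.6.1 (table: `E_i`).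

## What is proved (`X = E_i × E_i = prodPeriod (ellipticPeriod hI) (ellipticPeriod hI)`, `u = swapI ⊗ ℚ ∈ End_ℚ(X)`,
`ζ = zeta 8 ℚ ℚ(ζ_8)`, `Φ_8(u)` = the CM type of the Roan factor `Y_8`, `A₋ = fromBlocks 1 0 0 (−1)`)

* §1 `map_intCast_fromBlocks_one_neg_one`, `fromBlocks_one_neg_one_mem_endAlgRat_prod`, `det_fromBlocks_one_neg_one`,
  **`isIsogeny_fromBlocks_one_neg_one`** (any `X₁ × X₂`).
* §2 `fromBlocks_one_neg_one_mul_swapI` (`A₋ u = −u A₋`), `swapI_map_pow_five` (`u⁵ = −u`),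
  **`exists_isIsogeny_swapI_pow_five`** (`u ∼ u⁵`), **`not_exists_isIsogeny_swapI_pow_seven`** (`u ≁ u⁷`),
  **`not_exists_isIsogeny_swapI_pow_three`** (`u ≁ u³`), `hasEigenvalue_pow_five_of_hasEigenvalue_swapI`.
* §3 `eight_mem_eigenvalueOrders_swapI`, **`inducedCMType_cmType_roanFactor_swapI_eq_self`** (`τζ = ζ⁵ ⟹ Φ_8(u)τ = Φ_8(u)`),
  `apply_zeta_sq_of_apply_zeta_eq_pow_five` (`τ_5` fixes `ζ² = i`), `inducedCMType_cmType_roanFactor_swapI_ne_self_seven`,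
  **`inducedCMType_cmType_roanFactor_swapI_ne_self_three`**, **`not_isSimple_roanFactor_swapI`**.

## References

* [Shimura1998] G. Shimura, *Abelian Varieties with Complex Multiplication and Modular Functions*, Princeton Univ.
  Press (1998), §5.2 p. 39, §6.2 Thm. 3 p. 42, §8.4 Example (2) p. 73.
* [DolgachevZarhin2024] I. Dolgachev, Yu. G. Zarhin, *Endomorphisms of Complex Abelian Varieties* (2024), §2.2 Thm. 2.18.
* [Streng2010] M. Streng, *Complex multiplication of abelian surfaces*, PhD thesis, Leiden (2010), Ch. I §3–§4, (3.6).
* [Lange2023AbelianVarietiesComplex] H. Lange, *Abelian Varieties over the Complex Numbers* (2023), §1.1.2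
  Lemma 1.1.11, Cor. 1.1.16; §2.4.4 Cor. 2.4.26; §2.6.1.
-/

noncomputable section

open Module Function Polynomial Finset
open scoped Matrix

namespace Literature.Geometry.Kaehler

namespace ComplexTorus

open CyclotomicIdempotents
open Literature.NumberTheory.ComplexMultiplication (IsCMTorusRat inducedCMType twist_mul)

/-! ### §1 The automorphism `(x₁, x₂) ↦ (x₁, −x₂)` of a product torus -/

section ProductSign

variable {ι₁ ι₂ : Type} [Fintype ι₁] [Fintype ι₂] [DecidableEq ι₁] [DecidableEq ι₂]
  {E₁ E₂ : Type} [NormedAddCommGroup E₁] [NormedSpace ℂ E₁] [NormedAddCommGroup E₂] [NormedSpace ℂ E₂]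
  (Φ₁ : (ι₁ → ℝ) ≃L[ℝ] E₁) (Φ₂ : (ι₂ → ℝ) ≃L[ℝ] E₂)

omit [Fintype ι₁] [Fintype ι₂] [DecidableEq ι₁] [DecidableEq ι₂] in
/-- `(1 0; 0 −1)_ℚ = (1 0; 0 −1)`. [cite: Lange2023AbelianVarietiesComplex, §2.4.4 Cor. 2.4.26 (proof: block form), p. 124] -/
theorem map_intCast_fromBlocks_one_neg_one [DecidableEq ι₁] [DecidableEq ι₂] :
    (_root_.Matrix.fromBlocks (1 : Matrix ι₁ ι₁ ℤ) 0 0 (-1 : Matrix ι₂ ι₂ ℤ)).map (Int.cast : ℤ → ℚ) =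
      _root_.Matrix.fromBlocks (1 : Matrix ι₁ ι₁ ℚ) 0 0 (-1 : Matrix ι₂ ι₂ ℚ) := by
  rw [_root_.Matrix.fromBlocks_map, _root_.Matrix.map_zero _ Int.cast_zero, _root_.Matrix.map_zero _ Int.cast_zero,
    _root_.Matrix.map_neg _ Int.cast_neg, _root_.Matrix.map_one _ Int.cast_zero Int.cast_one,
    _root_.Matrix.map_one _ Int.cast_zero Int.cast_one]

/-- **`(1 0; 0 −1) ∈ End_ℚ(X₁ × X₂)`** (`±1 ∈ End_ℚ(Xᵢ)`, block form). [cite: Lange2023AbelianVarietiesComplex, §2.4.4 Cor. 2.4.26 (proof), p. 124] -/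
theorem fromBlocks_one_neg_one_mem_endAlgRat_prod :
    _root_.Matrix.fromBlocks (1 : Matrix ι₁ ι₁ ℚ) 0 0 (-1 : Matrix ι₂ ι₂ ℚ) ∈ endAlgRat (prodPeriod Φ₁ Φ₂) :=
  (fromBlocks_mem_endAlgRat_prod_iff _ _).2
    ⟨Subalgebra.one_mem _, Submodule.zero_mem _, Submodule.zero_mem _, neg_mem (Subalgebra.one_mem _)⟩

omit [DecidableEq ι₁] [DecidableEq ι₂] in
/-- `det (1 0; 0 −1) = (−1)^{#ι₂} ≠ 0`. [cite: Lange2023AbelianVarietiesComplex, §1.1.2 Lemma 1.1.11, p0021] -/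
theorem det_fromBlocks_one_neg_one [DecidableEq ι₁] [DecidableEq ι₂] :
    (_root_.Matrix.fromBlocks (1 : Matrix ι₁ ι₁ ℤ) 0 0 (-1 : Matrix ι₂ ι₂ ℤ)).det = (-1) ^ Fintype.card ι₂ := by
  rw [_root_.Matrix.det_fromBlocks_zero₂₁, _root_.Matrix.det_one, one_mul, _root_.Matrix.det_neg, _root_.Matrix.det_one,
    mul_one]

/-- **`(x₁, x₂) ↦ (x₁, −x₂)` is an isogeny (an automorphism) of `X₁ × X₂`.**
[cite: Lange2023AbelianVarietiesComplex, §1.1.2 Lemma 1.1.11 and Cor. 1.1.16, p0021–p0022] -/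
theorem isIsogeny_fromBlocks_one_neg_one :
    IsIsogeny (prodPeriod Φ₁ Φ₂) (prodPeriod Φ₁ Φ₂)
      (_root_.Matrix.fromBlocks (1 : Matrix ι₁ ι₁ ℤ) 0 0 (-1 : Matrix ι₂ ι₂ ℤ)) := by
  refine isIsogeny_of_mem_endRingInt _ ?_ ?_
  · rw [mem_endRingInt_iff, map_intCast_fromBlocks_one_neg_one]
    exact fromBlocks_one_neg_one_mem_endAlgRat_prod Φ₁ Φ₂
  · rw [det_fromBlocks_one_neg_one]
    exact pow_ne_zero _ (by norm_num)

end ProductSign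

/-! ### §2 `E_i × E_i`: `u ∼ u⁵ = −u`, `u ≁ u⁷`, `u ≁ u³` -/

section Swap

/-- **`(1 0; 0 −1) u = −u (1 0; 0 −1)`** for `u = (0 J; 1 0)`: `(z, w) ↦ (z, −w)` anti-commutes with
`(z, w) ↦ (iw, z)`. [cite: DolgachevZarhin2024, §2.2 Thm. 2.18, p0036] -/
theorem fromBlocks_one_neg_one_mul_swapI :
    _root_.Matrix.fromBlocks (1 : Matrix (Fin 2) (Fin 2) ℚ) 0 0 (-1 : Matrix (Fin 2) (Fin 2) ℚ) *
        swapI.map (Int.cast : ℤ → ℚ) =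
      -swapI.map (Int.cast : ℤ → ℚ) *
        _root_.Matrix.fromBlocks (1 : Matrix (Fin 2) (Fin 2) ℚ) 0 0 (-1 : Matrix (Fin 2) (Fin 2) ℚ) := by
  rw [swapI_map_intCast, _root_.Matrix.fromBlocks_multiply, _root_.Matrix.fromBlocks_neg,
    _root_.Matrix.fromBlocks_multiply]
  simp

/-- **`u⁵ = −u`** (`u⁴ = −1`). [cite: DolgachevZarhin2024, §2.2 Thm. 2.18, p0036] -/
theorem swapI_map_pow_five : (swapI.map (Int.cast : ℤ → ℚ)) ^ 5 = -swapI.map (Int.cast : ℤ → ℚ) := by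
  rw [pow_succ, swapI_map_pow_four, neg_one_mul]

variable (hI : Complex.I.im ≠ 0)

/-- **`u ∼ u⁵`: the isogeny `(z, w) ↦ (z, −w)` of `E_i × E_i` conjugates `u = ((z, w) ↦ (iw, z))` to `u⁵ = −u`.**
[cite: Shimura1998, §8.4 Example (2) («transformed onto each other by an automorphism of `F`»), p. 73] [cite: DolgachevZarhin2024, §2.2 Thm. 2.18, p0036] -/
theorem exists_isIsogeny_swapI_pow_five :
    ∃ A : Matrix (Fin 2 ⊕ Fin 2) (Fin 2 ⊕ Fin 2) ℤ,
      IsIsogeny (prodPeriod (ellipticPeriod hI) (ellipticPeriod hI)) (prodPeriod (ellipticPeriod hI) (ellipticPeriod hI)) A ∧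
        A.map (Int.cast : ℤ → ℚ) * swapI.map (Int.cast : ℤ → ℚ) =
          (swapI.map (Int.cast : ℤ → ℚ)) ^ 5 * A.map (Int.cast : ℤ → ℚ) :=
  ⟨_, isIsogeny_fromBlocks_one_neg_one (ellipticPeriod hI) (ellipticPeriod hI), by
    rw [map_intCast_fromBlocks_one_neg_one, fromBlocks_one_neg_one_mul_swapI, swapI_map_pow_five]⟩

/-- **`u ≁ u⁷ = u⁻¹`**: no isogeny of `E_i × E_i` conjugates `u` to `u⁷` (FILE 1: a certificate is never conjugate to
its inverse). [cite: Shimura1998, §5.2, p. 39; §8.5 proof of Prop. 31, p. 78] -/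
theorem not_exists_isIsogeny_swapI_pow_seven :
    ¬ ∃ A : Matrix (Fin 2 ⊕ Fin 2) (Fin 2 ⊕ Fin 2) ℤ,
      IsIsogeny (prodPeriod (ellipticPeriod hI) (ellipticPeriod hI)) (prodPeriod (ellipticPeriod hI) (ellipticPeriod hI)) A ∧
        A.map (Int.cast : ℤ → ℚ) * swapI.map (Int.cast : ℤ → ℚ) =
          (swapI.map (Int.cast : ℤ → ℚ)) ^ 7 * A.map (Int.cast : ℤ → ℚ) :=
  not_exists_isIsogeny_pow_sub_one (u := ⟨swapI.map (Int.cast : ℤ → ℚ), swapI_mem_endAlgRat hI⟩) (by norm_num)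
    (swapEnd_pow_eight hI) squarefree_charpoly_swapI

/-- `B M = M' B ⟹ B Mᵏ = M'ᵏ B`. [folklore] -/
private theorem mul_pow_eq_pow_mul₃₀' {κ : Type} [Fintype κ] [DecidableEq κ] {B M M' : Matrix κ κ ℚ}
    (h : B * M = M' * B) (k : ℕ) : B * M ^ k = M' ^ k * B := by
  induction k with
  | zero => rw [pow_zero, pow_zero, _root_.Matrix.mul_one, _root_.Matrix.one_mul]
  | succ k ih => rw [pow_succ, pow_succ, ← _root_.Matrix.mul_assoc, ih, _root_.Matrix.mul_assoc, h, _root_.Matrix.mul_assoc]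

/-- **`u ≁ u³`**: an isogeny `A` with `A u = u³ A`, composed with `B u = u⁵ B` (§2), would conjugate `u` to
`u¹⁵ = u⁷ = u⁻¹`. So among `k ∈ (ℤ/8)^× = {1, 3, 5, 7}` exactly `u ∼ u¹`, `u ∼ u⁵` hold.
[cite: Shimura1998, §8.4 Example (2), p. 73; §5.2, p. 39] [cite: Lange2023AbelianVarietiesComplex, §1.1.2 Cor. 1.1.16 (isogenies compose), p0022] -/
theorem not_exists_isIsogeny_swapI_pow_three :
    ¬ ∃ A : Matrix (Fin 2 ⊕ Fin 2) (Fin 2 ⊕ Fin 2) ℤ,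
      IsIsogeny (prodPeriod (ellipticPeriod hI) (ellipticPeriod hI)) (prodPeriod (ellipticPeriod hI) (ellipticPeriod hI)) A ∧
        A.map (Int.cast : ℤ → ℚ) * swapI.map (Int.cast : ℤ → ℚ) =
          (swapI.map (Int.cast : ℤ → ℚ)) ^ 3 * A.map (Int.cast : ℤ → ℚ) := by
  rintro ⟨A, hA, hcommA⟩
  obtain ⟨B, hB, hcommB⟩ := exists_isIsogeny_swapI_pow_five hI
  apply not_exists_isIsogeny_swapI_pow_seven hI
  refine ⟨A * B, IsIsogeny.mul _ _ _ hA hB, ?_⟩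
  have hmap : (A * B).map (Int.cast : ℤ → ℚ) = A.map (Int.cast : ℤ → ℚ) * B.map (Int.cast : ℤ → ℚ) :=
    _root_.Matrix.map_mul (f := Int.castRingHom ℚ)
  have h15 : (swapI.map (Int.cast : ℤ → ℚ)) ^ 15 = (swapI.map (Int.cast : ℤ → ℚ)) ^ 7 := by
    rw [show (15 : ℕ) = 8 + 7 from rfl, pow_add, swapI_map_pow_eight, one_mul]
  rw [hmap, _root_.Matrix.mul_assoc, hcommB, ← _root_.Matrix.mul_assoc, mul_pow_eq_pow_mul₃₀' hcommA 5, ← pow_mul,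
    show 3 * 5 = 15 from rfl, h15, _root_.Matrix.mul_assoc]

/-- **`Spec ρ_a(u)` is stable under `μ ↦ μ⁵`** (FILE 1 §6 with the isogeny of §2; indeed `Spec ρ_a(u) = {ζ_8, ζ_8⁵}` or
its conjugate). [cite: Shimura1998, §5.2, p. 39; §8.5 proof of Prop. 30, p. 77] -/
theorem hasEigenvalue_pow_five_of_hasEigenvalue_swapI {μ : ℂ}
    (hμ : Module.End.HasEigenvalue
      (analyticRepHom (prodPeriod (ellipticPeriod hI) (ellipticPeriod hI))
        ⟨swapI.map (Int.cast : ℤ → ℚ), swapI_mem_endAlgRat hI⟩ : (ℂ × ℂ) →ₗ[ℂ] (ℂ × ℂ)) μ) :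
    Module.End.HasEigenvalue
      (analyticRepHom (prodPeriod (ellipticPeriod hI) (ellipticPeriod hI))
        ⟨swapI.map (Int.cast : ℤ → ℚ), swapI_mem_endAlgRat hI⟩ : (ℂ × ℂ) →ₗ[ℂ] (ℂ × ℂ)) (μ ^ 5) := by
  obtain ⟨A, hA, hcomm⟩ := exists_isIsogeny_swapI_pow_five hI
  exact hasEigenvalue_pow_of_isIsogeny_pow hA hcomm hμ

end Swap

/-! ### §3 The CM type `Φ_8(u)` of the Roan factor `Y_8`: stabiliser `{1, τ_5}`, not simple -/

section RoanFactor

variable (hI : Complex.I.im ≠ 0)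

/-- `8 ∈ D(u) = {8}`. [cite: Shimura1998, §6.2 Thm. 3 (type `(ℚ(ζ_8); {φᵢ})`), p. 42] -/
theorem eight_mem_eigenvalueOrders_swapI :
    8 ∈ eigenvalueOrders 8 (⟨swapI.map (Int.cast : ℤ → ℚ), swapI_mem_endAlgRat hI⟩ :
      endAlgRat (prodPeriod (ellipticPeriod hI) (ellipticPeriod hI))) := by
  rw [eigenvalueOrders_swapI]
  exact Finset.mem_singleton_self 8

/-- **`Φ_8(u)τ_5 = Φ_8(u)`**: the CM type of the Roan factor `Y_8` of `(E_i × E_i, u)` is fixed by `τ_5 : ζ_8 ↦ ζ_8⁵`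
(FILE 1 §6 with `u ∼ u⁵`). [cite: Shimura1998, §8.4 Example (2) (non-primitive types have non-trivial stabiliser), p. 73]
[cite: Streng2010, Ch. I (3.6) («`Gal(L/K₁) = {σ | Φ_L σ = Φ_L}`»), p. 20] -/
theorem inducedCMType_cmType_roanFactor_swapI_eq_self {τ : CyclotomicField 8 ℚ ≃ₐ[ℚ] CyclotomicField 8 ℚ}
    (hτ : τ (IsCyclotomicExtension.zeta 8 ℚ (CyclotomicField 8 ℚ)) = IsCyclotomicExtension.zeta 8 ℚ (CyclotomicField 8 ℚ) ^ 5) :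
    inducedCMType (τ.symm : CyclotomicField 8 ℚ →+* CyclotomicField 8 ℚ)
        (isCMTorusRat_roanFactor_of_squarefree (prodPeriod (ellipticPeriod hI) (ellipticPeriod hI)) (by norm_num)
          (swapEnd_pow_eight hI) squarefree_charpoly_swapI (eight_mem_eigenvalueOrders_swapI hI)).cmType =
      (isCMTorusRat_roanFactor_of_squarefree (prodPeriod (ellipticPeriod hI) (ellipticPeriod hI)) (by norm_num)
          (swapEnd_pow_eight hI) squarefree_charpoly_swapI (eight_mem_eigenvalueOrders_swapI hI)).cmType := by
  obtain ⟨A, hA, hcomm⟩ := exists_isIsogeny_swapI_pow_five hI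
  exact inducedCMType_cmType_roanFactor_eq_self_of_isIsogeny_pow (by norm_num) (swapEnd_pow_eight hI)
    squarefree_charpoly_swapI (eight_mem_eigenvalueOrders_swapI hI) hA hcomm hτ

/-- `τ_5` fixes `ζ_8² = i`: the stabiliser `{1, τ_5}` is the group of `ℚ(ζ_8)` over `ℚ(i)`, so `Φ_8(u)` is induced from
`ℚ(i)` — as it must be, `Y_8 ∼ E_i²`. [cite: Shimura1998, §8.4 Example (2), p. 73] [cite: DolgachevZarhin2024, §2.2 Thm. 2.18 (`A ∼ B^r`), p0036] -/
theorem apply_zeta_sq_of_apply_zeta_eq_pow_five {τ : CyclotomicField 8 ℚ ≃ₐ[ℚ] CyclotomicField 8 ℚ}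
    (hτ : τ (IsCyclotomicExtension.zeta 8 ℚ (CyclotomicField 8 ℚ)) = IsCyclotomicExtension.zeta 8 ℚ (CyclotomicField 8 ℚ) ^ 5) :
    τ (IsCyclotomicExtension.zeta 8 ℚ (CyclotomicField 8 ℚ) ^ 2) = IsCyclotomicExtension.zeta 8 ℚ (CyclotomicField 8 ℚ) ^ 2 := by
  rw [map_pow, hτ, ← pow_mul, show 5 * 2 = 8 + 2 from rfl, pow_add,
    (IsCyclotomicExtension.zeta_spec 8 ℚ (CyclotomicField 8 ℚ)).pow_eq_one, one_mul]

/-- **`Φ_8(u)τ_7 ≠ Φ_8(u)`** (`τ_7 = τ_{−1}` is complex conjugation: `Φ_8(u)τ_7 = Φ̄_8(u)`).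
[cite: Shimura1998, §5.2, p. 39; §8.4 Example (2), p. 73] -/
theorem inducedCMType_cmType_roanFactor_swapI_ne_self_seven {τ : CyclotomicField 8 ℚ ≃ₐ[ℚ] CyclotomicField 8 ℚ}
    (hτ : τ (IsCyclotomicExtension.zeta 8 ℚ (CyclotomicField 8 ℚ)) = IsCyclotomicExtension.zeta 8 ℚ (CyclotomicField 8 ℚ) ^ 7) :
    inducedCMType (τ.symm : CyclotomicField 8 ℚ →+* CyclotomicField 8 ℚ)
        (isCMTorusRat_roanFactor_of_squarefree (prodPeriod (ellipticPeriod hI) (ellipticPeriod hI)) (by norm_num)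
          (swapEnd_pow_eight hI) squarefree_charpoly_swapI (eight_mem_eigenvalueOrders_swapI hI)).cmType ≠
      (isCMTorusRat_roanFactor_of_squarefree (prodPeriod (ellipticPeriod hI) (ellipticPeriod hI)) (by norm_num)
          (swapEnd_pow_eight hI) squarefree_charpoly_swapI (eight_mem_eigenvalueOrders_swapI hI)).cmType := by
  apply inducedCMType_symm_ne_self_of_apply_zeta_eq_inv
  rw [hτ]
  symm
  apply inv_eq_of_mul_eq_one_left
  rw [← pow_succ, (IsCyclotomicExtension.zeta_spec 8 ℚ (CyclotomicField 8 ℚ)).pow_eq_one]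

/-- **`Φ_8(u)τ_3 ≠ Φ_8(u)`**: otherwise, twisting further by `τ_5` (which fixes the type), `Φ_8(u)` would be fixed by
`τ_3 τ_5 = τ_7 = τ_{−1}`.  THE STABILISER OF `Φ_8(u)` IN `Aut ℚ(ζ_8) = {τ_1, τ_3, τ_5, τ_7}` IS `{τ_1, τ_5}`.
[cite: Shimura1998, §8.4 Example (2), p. 73] [cite: Streng2010, Ch. I §3 («`Φ₂ = Φ₁σ`», a right action), p. 20] -/
theorem inducedCMType_cmType_roanFactor_swapI_ne_self_three {τ : CyclotomicField 8 ℚ ≃ₐ[ℚ] CyclotomicField 8 ℚ}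
    (hτ : τ (IsCyclotomicExtension.zeta 8 ℚ (CyclotomicField 8 ℚ)) = IsCyclotomicExtension.zeta 8 ℚ (CyclotomicField 8 ℚ) ^ 3) :
    inducedCMType (τ.symm : CyclotomicField 8 ℚ →+* CyclotomicField 8 ℚ)
        (isCMTorusRat_roanFactor_of_squarefree (prodPeriod (ellipticPeriod hI) (ellipticPeriod hI)) (by norm_num)
          (swapEnd_pow_eight hI) squarefree_charpoly_swapI (eight_mem_eigenvalueOrders_swapI hI)).cmType ≠
      (isCMTorusRat_roanFactor_of_squarefree (prodPeriod (ellipticPeriod hI) (ellipticPeriod hI)) (by norm_num)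
          (swapEnd_pow_eight hI) squarefree_charpoly_swapI (eight_mem_eigenvalueOrders_swapI hI)).cmType := by
  intro h3
  obtain ⟨τ₅, hτ₅⟩ := exists_algEquiv_apply_zeta_eq_pow (d := 8) (k := 5) (by norm_num)
  have h7 : (τ * τ₅) (IsCyclotomicExtension.zeta 8 ℚ (CyclotomicField 8 ℚ)) =
      IsCyclotomicExtension.zeta 8 ℚ (CyclotomicField 8 ℚ) ^ 7 := by
    rw [AlgEquiv.mul_apply, hτ₅, map_pow, hτ, ← pow_mul, show 3 * 5 = 8 + 7 from rfl, pow_add,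
      (IsCyclotomicExtension.zeta_spec 8 ℚ (CyclotomicField 8 ℚ)).pow_eq_one, one_mul]
  apply inducedCMType_cmType_roanFactor_swapI_ne_self_seven hI h7
  rw [twist_mul, h3, inducedCMType_cmType_roanFactor_swapI_eq_self hI hτ₅]

/-- **THE ROAN FACTOR `Y_8` OF `(E_i × E_i, u)` IS NOT SIMPLE** (FILE 2: on a simple factor an isogeny `A u = u⁵ A` would
force `ζ_8⁵ = ζ_8`; indeed `Y_8 ∼ E_i × E_i ∼ E_i²` and `Φ_8(u)` is induced from `ℚ(i)`).
[cite: DolgachevZarhin2024, §2.2 Thm. 2.18 (the alternative `A ∼ B^r`, `r = 2`), p0036] [cite: Shimura1998, §8.2 Prop. 26, p. 69; §8.4 Example (2), p. 73] -/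
theorem not_isSimple_roanFactor_swapI :
    ¬ IsSimple (idemPeriod (prodPeriod (ellipticPeriod hI) (ellipticPeriod hI))
      (cyclicIdempotent 8 (⟨swapI.map (Int.cast : ℤ → ℚ), swapI_mem_endAlgRat hI⟩ :
        endAlgRat (prodPeriod (ellipticPeriod hI) (ellipticPeriod hI))) 8)) := by
  intro hS
  obtain ⟨A, hA, hcomm⟩ := exists_isIsogeny_swapI_pow_five hI
  have hζ := IsCyclotomicExtension.zeta_spec 8 ℚ (CyclotomicField 8 ℚ)
  have h5 := zeta_pow_eq_zeta_of_isSimple_of_isIsogeny_pow (by norm_num) (swapEnd_pow_eight hI)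
    squarefree_charpoly_swapI (eight_mem_eigenvalueOrders_swapI hI) hS hA (k := 5) (by norm_num) hcomm
  have h4 : IsCyclotomicExtension.zeta 8 ℚ (CyclotomicField 8 ℚ) ^ 4 = 1 := by
    have h1 : IsCyclotomicExtension.zeta 8 ℚ (CyclotomicField 8 ℚ) ^ 4 * IsCyclotomicExtension.zeta 8 ℚ (CyclotomicField 8 ℚ) =
        1 * IsCyclotomicExtension.zeta 8 ℚ (CyclotomicField 8 ℚ) := by rw [← pow_succ, h5, one_mul]
    exact mul_right_cancel₀ (hζ.ne_zero (by norm_num)) h1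
  exact absurd ((hζ.pow_eq_one_iff_dvd 4).1 h4) (by norm_num)

end RoanFactor

end ComplexTorus

end Literature.Geometry.Kaehler

end
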